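import Summits.NavierStokesRegularity.NavierStokesRegularity.Theorems.ExtremiserTransienceBackwardConeEstimate
import HarnessLib

/-!
# Backward-cone propagation of scale-invariant levels for Type-I ancient mild fields

Helper file for rung R8 `ScrewSymmetricLiouville` of LINE g9-β `filament_selection` on crux
stmt-NavierStokesRegularity-26567 (`NearExtremalTransiencePerFlow`). SYMMETRY-FREE.

**Theorem** (`exists_backwardCone_violator`). There is a universal `ε₁ > 0` such that for every
level `0 < ε ≤ ε₁` and every Type-I constant `C` there is a radius `ρ = ρ(ε, C)` with: for every
`u ∈ A_C` (`IsTypeIAncientMild C u`), every `t₀ < 0` and `x₀` with `√(−t₀)‖u(t₀, x₀)‖ > ε`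
there is `x'` with `‖x' − x₀‖ ≤ ρ√(−t₀)` and `√(−36 t₀)‖u(36 t₀, x')‖ > ε`.

So violators of scale-invariant smallness propagate BACKWARD in time inside parabolic cones
WITHOUT LOSS OF LEVEL: the sup norm does not increase under the heat flow while the Type-I weight
`√(−t)` gains the factor `6` from `36 t₀` to `t₀`, which pays for the localisation errors.

Proof (`backwardCone_normalised`, after the Navier–Stokes zoom to `t₀ = −1`, `x₀ = 0`): if
`‖v(−36, y)‖ ≤ ε/6` on `‖y‖ ≤ ρ`, `ρ = 6K + 1`, a localised Kato bootstrap on the shrinking zone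
`Z = {(τ, y) : −36 ≤ τ ≤ −1, ‖y‖ ≤ ρ − K√(τ + 36)}` gives `‖v‖ ≤ 2a` on `Z`, `a = ε/6 + O(C/K) +
O(C²/√K)`: the mild formula from `s = −36` (`mild_eq_heatExtension`), the caloric term by
`norm_heatExtension_le_of_small_on_ball` (distance `≥ K√(τ+36)` to the large data), the Duhamel
term split along `Z ⊔ Zᶜ` (`oseenDuhamel_eq_add_of_indicator_compl_spaceTime`): near part
`≤ 12 C_B M²` (`exists_norm_oseenDuhamel_bounded_le`, `M` = running sup on the zone), far part
`≤ 12 C₁ C² (K/6)^{-1/2}` (`exists_norm_oseenDuhamel_far_le`; points outside the zone at time `τ`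
are at distance `≥ (K/12)(t − τ)` from the zone at time `t`, `zone_gap`). The running sup never
enters `(2a, 1/(2 C_B'))` and starts below; a first bad point is excluded by continuity in time at a
fixed space point (the zone shrinks, so earlier slices contain it).
[cite: KochNadirashviliSereginSverak2009, §3 (3.8), §4 p. 8 (arXiv:0709.3599)]
-/

noncomputable section

set_option linter.dupNamespace false

open Set Function Filter MeasureTheory Metric
open scoped Topology ENNReal

namespace Summit.NavierStokesRegularity.NavierStokesRegularity.Theorems.ScrewSymmetricLiouville

open Literature.Analysis Literature.Analysis.FluidPDE Literature.Analysis.UnboundedOperators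
open Summit.NavierStokesRegularity.NavierStokesRegularity.Theorems

/-! ### The bootstrap on the shrinking zone (normalised form) -/

/-- **Backward-cone propagation, normalised form** (`t₀ = −1`, `x₀ = 0`): there is a universal
`ε₁ > 0` such that for `0 < ε ≤ ε₁` and every `C` there is `ρ > 0` with: every `v ∈ A_C` with
`‖v(−36, y)‖ ≤ ε/6` on `‖y‖ ≤ ρ` satisfies `‖v(−1, 0)‖ ≤ ε`. Module docstring for the proof. [cite: KochNadirashviliSereginSverak2009, §4 p. 8 (arXiv:0709.3599)] -/
theorem backwardCone_normalised :
    ∃ ε₁ : ℝ, 0 < ε₁ ∧ ∀ ε : ℝ, 0 < ε → ε ≤ ε₁ → ∀ C : ℝ, ∃ ρ : ℝ, 0 < ρ ∧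
      ∀ v : ℝ → EuclideanSpace ℝ (Fin 3) → EuclideanSpace ℝ (Fin 3), IsTypeIAncientMild C v →
        (∀ y : EuclideanSpace ℝ (Fin 3), ‖y‖ ≤ ρ → ‖v (-36) y‖ ≤ ε / 6) → ‖v (-1) 0‖ ≤ ε := by
  obtain ⟨CB, hCB, hB0⟩ := exists_norm_oseenDuhamel_bounded_le (E := EuclideanSpace ℝ (Fin 3))
  obtain ⟨C₁, hC₁, hF⟩ := exists_norm_oseenDuhamel_far_le
  have hB : ∀ {u w : ℝ → EuclideanSpace ℝ (Fin 3) → EuclideanSpace ℝ (Fin 3)} {s t M : ℝ}, s < t →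
      0 ≤ M → (∀ τ ∈ Ioo s t, ∀ y, ‖u τ y‖ ≤ M) → (∀ τ ∈ Ioo s t, ∀ y, ‖w τ y‖ ≤ M) →
      ∀ x : EuclideanSpace ℝ (Fin 3),
        ‖oseenDuhamel 1 s u w t x‖ ≤ CB * M ^ 2 * (1 : ℝ) ^ (-(1 / 2 : ℝ)) * (2 * Real.sqrt (t - s)) :=
    fun hst hM hu hw x => hB0 one_pos hst hM hu hw x
  set b : ℝ := 12 * CB with hb
  have hb0 : 0 < b := by positivity
  refine ⟨1 / (4 * b), by positivity, fun ε hε hε₁ C => ?_⟩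
  set A₀ : ℝ := 2 * (2 : ℝ) ^ ((Module.finrank ℝ (EuclideanSpace ℝ (Fin 3)) : ℝ) / 2) with hA₀
  have hA₀0 : 0 < A₀ := by positivity
  set C' : ℝ := max C 0 with hC'
  have hC'0 : 0 ≤ C' := le_max_right _ _
  -- the localisation parameter `K` and the radius `ρ = 6K + 1`
  set q : ℝ := 72 * C₁ * C' ^ 2 / ε with hq
  set K : ℝ := max 1 (max (6 * A₀ * C' / ε) (6 * q ^ 2)) with hK
  have hK1 : 1 ≤ K := le_max_left _ _
  have hK0 : 0 < K := by linarith
  have hKa : 6 * A₀ * C' / ε ≤ K := (le_max_left _ _).trans (le_max_right _ _)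
  have hKb : 6 * q ^ 2 ≤ K := (le_max_right _ _).trans (le_max_right _ _)
  set ρ : ℝ := 6 * K + 1 with hρ
  refine ⟨ρ, by positivity, fun v hv hdata => ?_⟩
  have hC : 0 ≤ C := hv.nonneg
  have hCC' : C' = C := max_eq_left hC
  -- the two tails are `≤ ε/6`
  have htails : C * A₀ / K + 12 * C₁ * C ^ 2 * (K / 6) ^ (-(1 / 2 : ℝ)) ≤ ε / 6 + ε / 6 := by
    rcases eq_or_lt_of_le hC with h0 | hCpos
    · rw [← h0]
      have e : (0 : ℝ) * A₀ / K + 12 * C₁ * 0 ^ 2 * (K / 6) ^ (-(1 / 2 : ℝ)) = 0 := by ring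
      rw [e]
      positivity
    · rw [hCC'] at hKa hq
      refine add_le_add ?_ ?_
      · rw [div_le_iff₀ hK0]
        calc C * A₀ = ε / 6 * (6 * A₀ * C / ε) := by field_simp
          _ ≤ ε / 6 * K := mul_le_mul_of_nonneg_left hKa (by positivity)
      · have hq0 : 0 < q := by rw [hq]; positivity
        have h1 : (K / 6) ^ (-(1 / 2 : ℝ)) ≤ (q ^ 2) ^ (-(1 / 2 : ℝ)) :=
          Real.rpow_le_rpow_of_nonpos (by positivity) (by linarith) (by norm_num)
        have h2 : (q ^ 2) ^ (-(1 / 2 : ℝ)) = q⁻¹ := by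
          rw [← Real.rpow_natCast, ← Real.rpow_mul hq0.le]
          norm_num
          exact Real.rpow_neg_one q
        rw [h2] at h1
        calc 12 * C₁ * C ^ 2 * (K / 6) ^ (-(1 / 2 : ℝ)) ≤ 12 * C₁ * C ^ 2 * q⁻¹ :=
              mul_le_mul_of_nonneg_left h1 (by positivity)
          _ = ε / 6 := by rw [hq]; field_simp; ring
  set a : ℝ := ε / 6 + C * A₀ / K + 12 * C₁ * C ^ 2 * (K / 6) ^ (-(1 / 2 : ℝ)) with ha
  have ha_le : a ≤ ε / 2 := by linarith
  have ha6 : ε / 6 ≤ a := by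
    have : 0 ≤ C * A₀ / K + 12 * C₁ * C ^ 2 * (K / 6) ^ (-(1 / 2 : ℝ)) := by positivity
    linarith
  have h2a_lt : 2 * a < 1 / (2 * b) := by
    have h1 : 1 / (4 * b) < 1 / (2 * b) := by
      rw [div_lt_div_iff₀ (by positivity) (by positivity)]; linarith
    linarith
  -- the zone `Z` and the size function `F`
  set R : ℝ → ℝ := fun τ => ρ - K * Real.sqrt (τ + 36) with hR
  have hRanti : ∀ {τ τ' : ℝ}, τ ≤ τ' → R τ' ≤ R τ := fun {τ τ'} h => by
    simp only [hR]
    have := Real.sqrt_le_sqrt (by linarith : τ + 36 ≤ τ' + 36)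
    nlinarith
  have hR36 : R (-36) = ρ := by simp [hR]
  have hR1 : 1 ≤ R (-1) := by
    simp only [hR, hρ]
    have : Real.sqrt (-1 + 36) ≤ 6 := by
      rw [show (6 : ℝ) = Real.sqrt (6 ^ 2) by rw [Real.sqrt_sq (by norm_num)]]
      exact Real.sqrt_le_sqrt (by norm_num)
    nlinarith
  set Z : Set (ℝ × EuclideanSpace ℝ (Fin 3)) := {p | -36 ≤ p.1 ∧ p.1 ≤ -1 ∧ ‖p.2‖ ≤ R p.1} with hZ
  set F : ℝ × EuclideanSpace ℝ (Fin 3) → ℝ := fun p => ‖v p.1 p.2‖ with hFdef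
  have hFc : ContinuousOn F Z := by
    refine (hv.continuousOn_uncurry.mono ?_).norm
    intro p hp
    have h1 : p.1 ≤ -1 := hp.2.1
    exact ⟨show p.1 < 0 by linarith, mem_univ _⟩
  have hRc : Continuous fun p : ℝ × EuclideanSpace ℝ (Fin 3) => R p.1 :=
    continuous_const.sub (continuous_const.mul ((continuous_fst.add continuous_const).sqrt))
  have hZcl : IsClosed Z := by
    simp only [hZ, Set.setOf_and]
    exact (isClosed_le continuous_const continuous_fst).inter
      ((isClosed_le continuous_fst continuous_const).inter
        (isClosed_le (continuous_norm.comp continuous_snd) hRc))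
  have hZc : IsCompact Z := by
    refine (isCompact_Icc.prod (isCompact_closedBall (0 : EuclideanSpace ℝ (Fin 3)) ρ)).of_isClosed_subset
      hZcl fun p hp => ⟨⟨hp.1, hp.2.1⟩, ?_⟩
    rw [mem_closedBall, dist_zero_right]
    refine hp.2.2.trans ?_
    have := hRanti hp.1
    rw [hR36] at this
    exact this
  -- KEY CLAIM: no bad point up to time `T₁` ⇒ `F ≤ 2a` up to time `T₁`
  have hclaim : ∀ T₁ : ℝ, -36 ≤ T₁ → T₁ ≤ -1 → (∀ p ∈ Z, p.1 ≤ T₁ → F p < 1 / (2 * b)) →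
      ∀ p ∈ Z, p.1 ≤ T₁ → F p ≤ 2 * a := by
    intro T₁ hT36 hT1 hgood
    set ZT : Set (ℝ × EuclideanSpace ℝ (Fin 3)) := Z ∩ {p | p.1 ≤ T₁} with hZT
    have hZTc : IsCompact ZT := hZc.inter_right (isClosed_le continuous_fst continuous_const)
    have h0Z : ((-36 : ℝ), (0 : EuclideanSpace ℝ (Fin 3))) ∈ ZT := by
      refine ⟨⟨le_rfl, by norm_num, ?_⟩, hT36⟩
      show ‖(0 : EuclideanSpace ℝ (Fin 3))‖ ≤ R (-36)
      rw [norm_zero, hR36]; positivity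
    obtain ⟨p₀, hp₀, hmax⟩ := hZTc.exists_isMaxOn ⟨_, h0Z⟩ (hFc.mono inter_subset_left)
    have hMle : ∀ p ∈ ZT, F p ≤ F p₀ := fun p hp => hmax hp
    have hM0 : 0 ≤ F p₀ := norm_nonneg _
    have hMlt : F p₀ < 1 / (2 * b) := hgood p₀ hp₀.1 hp₀.2
    -- `F p₀ ≤ a + b (F p₀)²`
    have hMq : F p₀ ≤ a + b * F p₀ ^ 2 := by
      obtain ⟨⟨h36, h1, hxR⟩, hT⟩ := hp₀
      have hT' : p₀.1 ≤ T₁ := hT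
      rcases eq_or_lt_of_le h36 with heq | hlt
      · have hd : F p₀ ≤ ε / 6 := by
          have hy : ‖p₀.2‖ ≤ ρ := by rw [← hR36, heq]; exact hxR
          have := hdata p₀.2 hy
          simp only [hFdef]
          rw [← heq]
          exact this
        have : 0 ≤ b * F p₀ ^ 2 := by positivity
        linarith
      · have hest := one_point_estimate hCB.le hC₁.le hB hF hv hK0 (by positivity : (0 : ℝ) ≤ ε / 6)
          hM0 hdata hlt h1 hxR (fun τ hτ y hy =>
            hMle (τ, y) ⟨⟨hτ.1.le, by linarith [hτ.2], hy⟩, by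
              show τ ≤ T₁
              linarith [hτ.2, hT']⟩)
        simp only [hFdef] at hest ⊢
        have e : a + b * ‖v p₀.1 p₀.2‖ ^ 2 =
            ε / 6 + C * A₀ / K + 12 * CB * ‖v p₀.1 p₀.2‖ ^ 2 + 12 * C₁ * C ^ 2 * (K / 6) ^ (-(1 / 2 : ℝ)) := by
          simp only [ha, hb, hA₀]; ring
        rw [e]
        exact hest
    -- hence `F p₀ ≤ 2a`
    have hM2a : F p₀ ≤ 2 * a := by
      by_contra hcon
      push Not at hcon
      have h1 : 2 * b * F p₀ < 1 := by
        rw [lt_div_iff₀ (by positivity)] at hMlt; linarith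
      have h2 : b * F p₀ ^ 2 ≤ F p₀ / 2 := by nlinarith
      linarith
    intro p hp hpT
    exact (hMle p ⟨hp, hpT⟩).trans hM2a
  -- there are no bad points
  have hallgood : ∀ p ∈ Z, F p < 1 / (2 * b) := by
    by_contra hcon
    push Not at hcon
    obtain ⟨p₁, hp₁Z, hp₁F⟩ := hcon
    set BAD : Set (ℝ × EuclideanSpace ℝ (Fin 3)) := Z ∩ F ⁻¹' (Ici (1 / (2 * b))) with hBAD
    have hBADc : IsCompact BAD :=
      hZc.of_isClosed_subset (hFc.preimage_isClosed_of_isClosed hZcl isClosed_Ici) inter_subset_left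
    obtain ⟨p, hp, hpmin⟩ := hBADc.exists_isMinOn ⟨p₁, hp₁Z, hp₁F⟩ continuous_fst.continuousOn
    obtain ⟨⟨hp36, hp1, hpR⟩, hpF⟩ := hp
    have hpF' : 1 / (2 * b) ≤ F p := hpF
    have hbelow : ∀ p' ∈ Z, p'.1 < p.1 → F p' < 1 / (2 * b) := by
      intro p' hp' hlt
      by_contra h
      push Not at h
      have : p.1 ≤ p'.1 := hpmin ⟨hp', h⟩
      linarith
    rcases eq_or_lt_of_le hp36 with heq | hlt
    · -- the bad point lies on the initial slice
      have hy : ‖p.2‖ ≤ ρ := by rw [← hR36, heq]; exact hpR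
      have hd : F p ≤ ε / 6 := by
        have := hdata p.2 hy
        simp only [hFdef]
        rw [← heq]
        exact this
      linarith
    · -- `F(τ, p.2) ≤ 2a` for `τ ∈ (-36, p.1)`, then continuity in `τ`
      have hev : ∀ τ ∈ Ioo (-36 : ℝ) p.1, F (τ, p.2) ≤ 2 * a := by
        intro τ hτ
        have hτ1 : τ ≤ -1 := by linarith [hτ.2]
        exact hclaim τ hτ.1.le hτ1 (fun p' hp' hp'τ => hbelow p' hp' (lt_of_le_of_lt hp'τ hτ.2))
          (τ, p.2) ⟨hτ.1.le, hτ1, hpR.trans (hRanti hτ.2.le)⟩ le_rfl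
      have hp0 : p.1 < 0 := by linarith
      have hcu : ContinuousAt (uncurry v) (p.1, p.2) :=
        hv.continuousOn_uncurry.continuousAt
          ((isOpen_Iio.prod isOpen_univ).mem_nhds ⟨mem_Iio.2 hp0, mem_univ _⟩)
      have hcts : ContinuousAt (fun τ : ℝ => F (τ, p.2)) p.1 := by
        have h2 : ContinuousAt (fun τ : ℝ => (τ, p.2)) p.1 := continuousAt_id.prodMk continuousAt_const
        exact (ContinuousAt.comp (f := fun τ : ℝ => (τ, p.2)) (x := p.1) hcu h2).norm
      have hlim : Tendsto (fun τ : ℝ => F (τ, p.2)) (𝓝[<] p.1) (𝓝 (F p)) :=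
        hcts.tendsto.mono_left nhdsWithin_le_nhds
      have hle : F p ≤ 2 * a :=
        le_of_tendsto hlim (mem_of_superset (Ioo_mem_nhdsLT hlt) fun τ hτ => hev τ hτ)
      linarith
  -- conclusion at `(-1, 0)`
  have h10 : ((-1 : ℝ), (0 : EuclideanSpace ℝ (Fin 3))) ∈ Z := by
    refine ⟨by norm_num, le_rfl, ?_⟩
    show ‖(0 : EuclideanSpace ℝ (Fin 3))‖ ≤ R (-1)
    rw [norm_zero]; linarith
  have hfin := hclaim (-1) (by norm_num) le_rfl (fun p hp _ => hallgood p hp) _ h10 le_rfl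
  calc ‖v (-1) 0‖ = F ((-1 : ℝ), (0 : EuclideanSpace ℝ (Fin 3))) := rfl
    _ ≤ 2 * a := hfin
    _ ≤ ε := by linarith

/-! ### Backward-cone propagation of violators -/

/-- **Backward-cone propagation of scale-invariant levels.** There is a universal `ε₁ > 0` such
that for every `0 < ε ≤ ε₁` and every `C` there is `ρ > 0` with: for every `u ∈ A_C`, every
`t₀ < 0` and `x₀` with `√(−t₀)‖u(t₀, x₀)‖ > ε`, some `x'` with `‖x' − x₀‖ ≤ ρ√(−t₀)` has
`√(−36t₀)‖u(36t₀, x')‖ > ε` (Navier–Stokes zoom about `(0, x₀)` + `backwardCone_normalised`). [cite: KochNadirashviliSereginSverak2009, §1 (1.2), §4 p. 8 (arXiv:0709.3599)] -/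
theorem exists_backwardCone_violator :
    ∃ ε₁ : ℝ, 0 < ε₁ ∧ ∀ ε : ℝ, 0 < ε → ε ≤ ε₁ → ∀ C : ℝ, ∃ ρ : ℝ, 0 < ρ ∧
      ∀ u : ℝ → EuclideanSpace ℝ (Fin 3) → EuclideanSpace ℝ (Fin 3), IsTypeIAncientMild C u →
        ∀ t₀ : ℝ, t₀ < 0 → ∀ x₀ : EuclideanSpace ℝ (Fin 3),
          ε < Real.sqrt (-t₀) * ‖u t₀ x₀‖ →
          ∃ x' : EuclideanSpace ℝ (Fin 3), ‖x' - x₀‖ ≤ ρ * Real.sqrt (-t₀) ∧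
            ε < Real.sqrt (-(36 * t₀)) * ‖u (36 * t₀) x'‖ := by
  obtain ⟨ε₁, hε₁, h⟩ := backwardCone_normalised
  refine ⟨ε₁, hε₁, fun ε hε hεε₁ C => ?_⟩
  obtain ⟨ρ, hρ, hρv⟩ := h ε hε hεε₁ C
  refine ⟨ρ, hρ, fun u hu t₀ ht₀ x₀ hviol => ?_⟩
  by_contra hcon
  push Not at hcon
  set lam : ℝ := Real.sqrt (-t₀) with hlam
  have hlam0 : 0 < lam := Real.sqrt_pos.2 (neg_pos.2 ht₀)
  have hlam2 : lam ^ 2 = -t₀ := Real.sq_sqrt (neg_nonneg.2 ht₀.le)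
  set v : ℝ → EuclideanSpace ℝ (Fin 3) → EuclideanSpace ℝ (Fin 3) :=
    lam • stPull (lam ^ 2) lam 0 x₀ u with hv
  have hvcl : IsTypeIAncientMild C v := isTypeIAncientMild_zoom hu hlam0 x₀
  have hv_apply : ∀ s y, v s y = lam • u (lam ^ 2 * s) (x₀ + lam • y) := fun s y =>
    zoom_apply lam x₀ u s y
  have h36 : Real.sqrt (-(36 * t₀)) = 6 * lam := by
    rw [show -(36 * t₀) = 6 ^ 2 * -t₀ by ring, Real.sqrt_mul' _ (neg_nonneg.2 ht₀.le),
      Real.sqrt_sq (by norm_num)]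
  have hdata : ∀ y : EuclideanSpace ℝ (Fin 3), ‖y‖ ≤ ρ → ‖v (-36) y‖ ≤ ε / 6 := by
    intro y hy
    rw [hv_apply, norm_smul, Real.norm_of_nonneg hlam0.le,
      show lam ^ 2 * (-36 : ℝ) = 36 * t₀ by rw [hlam2]; ring]
    have h1 := hcon (x₀ + lam • y) (by
      rw [add_sub_cancel_left, norm_smul, Real.norm_of_nonneg hlam0.le, mul_comm]
      exact mul_le_mul_of_nonneg_right hy hlam0.le)
    rw [h36] at h1
    linarith
  have hfin := hρv v hvcl hdata
  rw [hv_apply, smul_zero, add_zero, mul_neg_one, hlam2, neg_neg, norm_smul,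
    Real.norm_of_nonneg hlam0.le] at hfin
  exact absurd hviol (not_lt.2 hfin)

end Summit.NavierStokesRegularity.NavierStokesRegularity.Theorems.ScrewSymmetricLiouville

end
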